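import Summits.HodgeConjecture.HodgeConjecture.Theorems.F0P3cStCharTSUpTrTubeOrbitSum   -- ★ (N4)(c) p852425 `setIntegral_mul_orbitSum_cartanSet_eq` (this seat); brings ★ (N4-A)(N4-B), ★ (E1b), ★ (E3), ★ (E0)
import Literature.NumberTheory.Rogawski1990.LocalNormFibreNonsplit                      -- ★ `IsLocalNormPair.charpoly_eq`, `charpoly_endoEmbLocal` (regularity across a norm pair)
import HarnessLib

/-!
# F0 · P3c · ROAD «UP-TR» brick (A1′)-D «EXCHANGE»: THE TUBE FORMULA AT THE `G`-CARTAN `Z_G(γ)` READ ON THE `H`-CARTAN `Z_H(γ₀)` ALONG AN ADMISSIBLE EMBEDDING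
# `e : Z_H(γ₀) ≃ₜ* Z_G(γ)` — step (A-3) of Lemma 12.5.1's change of variables (Rogawski 1990 §12.5 pp. 182–183; Harish-Chandra 1970 Lemma 42; Langlands–Shelstad 1987 §1.3)

Cell `pub/hodgecm-mathlib`, crux H413 = `stmt-HodgeConjecture-24833` (lane `--supports … --as helper`); seat LH10-p01 (g8); ROAD «UP-TR» v2∕v3 (holder F0P3-p02 (g23)), brick (A1′)
«UP-TR ASSEMBLY», FILE D (the analytic core; ★-only imports).  THEOREMS ONLY; sorry-free; no definition ∕ instance ∕ notation ∕ named fact; axioms TRIO.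

WHAT.  `G = Gqs L v`, `H_v = U(Φ₂)(L⁺_v) × U(Φ₁)(L⁺_v)`, `v` non-split.  An `H`-Cartan `T_H = Z_H(γ₀)` (`γ₀` `G`-regular), a regular `γ ∈ G`, and an isomorphism of topological groups
`e : T_H ≃ₜ* T′ := Z_G(γ)` matching pointwise (`ι_v(s) ↔ e s`, ★ (N2b′) `exists_embFamily` clause (v)); THE compact-core-normalised Haar measures `tH` on `T_H` and `tT` on `T′`.
* `isLocalGRegular_iff_isRegularElt_of_isLocalNormPair` — across a norm pair `G`-regularity of `s ∈ H_v` IS regularity of its partner (same characteristic polynomial, ★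
  `IsLocalNormPair.charpoly_eq`, ★ `charpoly_endoEmbLocal`).
* `map_continuousMulEquiv_eq_of_apply_compactCore_eq_one` — `e_* tH = tT` (Haar uniqueness on the intrinsic compact core, ★ `image_compactCore`, ★ `eq_of_apply_compactCore_eq_one`).
* **`setIntegral_mul_orbitSum_embedding_eq`** — for `K : T′ → ℂ` (NOT conjugation invariant), `f` measurable and the two (A0)-class integrability inputs:
  `∫_{G_{T′}} f(y) · (Σ_{t ∈ T′, t ∼ y} K(t)) dνQv(y) = ∫_{s ∈ T_H, G-regular} √(∏_w |disc χ_{e s}|_w (∏_w |det (e s)|_w)⁻²) • (K(e s) · classOrbitalIntegral mQv f ⟦e s⟧) dtH(s)` —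
  ★ (N4)(c) `setIntegral_mul_orbitSum_cartanSet_eq` at `K`, then the change of variables `t = e s` (`e_* tH = tT`, `e⁻¹(T′^{reg}) = T_H^{G-reg}`).  This is the
  «TUBE FORMULA at the `G`-Cartan `ψ(T_H)` PARAMETRISED BY `ψ`» of ROAD v2 §A (A-3), one `(T_H, ψ)` at a time; the assembly (FILE E) sums it over `(T_H ∈ SHall, ψ ∈ Emb T_H)`.
HONEST LABEL: count-neutral; UP-TR block consequents move only at the rider editions; organs 2 = 2; h413 registry untouched; HC_CM is proved only modulo the printed citations
until rung 0 closes.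

## References
* [Rogawski1990] J. D. Rogawski, *Automorphic Representations of Unitary Groups in Three Variables*, Ann. of Math. Stud. 123 (1990), §12.5 pp. 182–183 (Lemma 12.5.1: «the measures
  on `T` and `T_H` correspond under `ψ`»), §4.3 (4.3.1) p. 43.
* [HarishChandra1970] Harish-Chandra (notes by G. van Dijk), *Harmonic analysis on reductive p-adic groups*, LNM 162 (1970), Part V §4 Lemma 42.
* [LanglandsShelstad1987] R. P. Langlands, D. Shelstad, *On the definition of transfer factors*, Math. Ann. 278 (1987), §1.3 (compatible measures on corresponding tori).
-/

set_option autoImplicit false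
-- the mandated namespace has the single-problem summit's repeated segment (`HodgeConjecture.HodgeConjecture`)
set_option linter.dupNamespace false

noncomputable section

open MeasureTheory Measure Set Filter Topology Function NumberField IsDedekindDomain Matrix
open Literature.MeasureTheory.Group
open Literature.NumberTheory.Automorphic Literature.NumberTheory.Automorphic.UnitaryGroup Literature.NumberTheory.Rogawski1990
open Literature.NumberTheory.GaloisRepresentations
open Summit.HodgeConjecture.HodgeConjecture.Cruxes.H413
open Summit.HodgeConjecture.HodgeConjecture.Cruxes.H413.F0P3cStCharTSWeylCartanRadial
open Summit.HodgeConjecture.HodgeConjecture.Cruxes.H413.F0P3cStCharTSUpTrTubeOrbitSum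
open scoped ENNReal NNReal MatrixGroups Pointwise

namespace Summit.HodgeConjecture.HodgeConjecture.Cruxes.H413.F0P3cStCharTSUpTrExchange

section CM

variable (L : Type) [Field L] [NumberField L] [IsCMField L] (v : HeightOneSpectrum (𝓞 ↥(maximalRealSubfield L)))

/-! ## §1 Regularity across a norm pair; transport of the canonical torus measure -/

/-- **Across a norm pair `ι_v(s) ↔ γ`, `s` is `G`-regular iff `γ` is regular** (both say that the common characteristic polynomial `χ_g · (X − u)` is separable; ★
`IsLocalNormPair.charpoly_eq`, ★ `charpoly_endoEmbLocal`, ★ `isRegularElt_iff`). [cite: Rogawski1990, §4.3 p. 42; §3.1 p. 19] -/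
theorem isLocalGRegular_iff_isRegularElt_of_isLocalNormPair
    {s : (UnitaryGroup.cmDatum L 2 (Matrix.of fun i j : Fin 2 => if i.val + j.val + 1 = 2 then (1 : L) else 0)).Local v ×
      (UnitaryGroup.cmDatum L 1 (Matrix.of fun i j : Fin 1 => if i.val + j.val + 1 = 1 then (1 : L) else 0)).Local v}
    {γ : Gqs L v} (h : IsLocalNormPair L (qsForm L) v s γ) :
    IsLocalGRegular L v s ↔ IsRegularElt (γ.val : GL (Fin 3) (UnitaryGroup.LocalRing L v)) := by
  constructor
  · exact fun hs => h.isRegularElt L (qsForm L) v hs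
  · intro hγ
    have hsep := (isRegularElt_iff _).1 hγ
    rw [h.charpoly_eq, ← charpoly_endoEmbLocal] at hsep
    exact hsep

/-- **Compact-core-normalised Haar measures correspond under an isomorphism of topological groups of Cartan subgroups**: for `e : T_H ≃ₜ* T′` (`T′ = Z_G(γ)` a Cartan of
`U(Φ₃)(L⁺_v)`), Haar measures `tH`, `tT` with mass one on the compact cores, `e_* tH = tT` (★ `image_compactCore`, ★ `eq_of_apply_compactCore_eq_one`) — «the measures on `T`
and `T_H` correspond». [cite: Rogawski1990, §12.5 p. 183; §4.3 p. 43] [cite: LanglandsShelstad1987, §1.3] -/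
theorem map_continuousMulEquiv_eq_of_apply_compactCore_eq_one
    {A : Type*} [Group A] [TopologicalSpace A] [IsTopologicalGroup A] [MeasurableSpace A] [BorelSpace A] (TH : Subgroup A)
    [MeasurableSpace (Gqs L v)] [BorelSpace (Gqs L v)] [LocallyCompactSpace (Gqs L v)] [SecondCountableTopology (Gqs L v)] [T2Space (Gqs L v)]
    {T' : Subgroup (Gqs L v)} {γ : Gqs L v} (hT' : T' = Subgroup.centralizer ({γ} : Set (Gqs L v)))
    (e : ↥TH ≃ₜ* ↥T') (tH : Measure ↥TH) [tH.IsHaarMeasure] (htH : tH (compactCore ↥TH) = 1)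
    (tT : Measure ↥T') [tT.IsHaarMeasure] (htT : tT (compactCore ↥T') = 1) :
    Measure.map e tH = tT := by
  have hTcl := isClosed_cartan hT'
  haveI : LocallyCompactSpace ↥T' := hTcl.isClosedEmbedding_subtypeVal.locallyCompactSpace
  haveI : SecondCountableTopology ↥T' := TopologicalSpace.Subtype.secondCountableTopology _
  haveI : (Measure.map e tH).IsHaarMeasure := ContinuousMulEquiv.isHaarMeasure_map tH e
  refine eq_of_apply_compactCore_eq_one _ _ ?_ htT
  have hme : MeasurableEmbedding (⇑e) := e.toHomeomorph.measurableEmbedding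
  rw [← image_compactCore e, hme.map_apply, e.injective.preimage_image, htH]

/-- **Change of variables along `e` for set integrals and integrability**: with `e_* tH = tT` and `e⁻¹(T′^{reg}) = T_H^{G-reg}` (pointwise matching), for every `Ψ : T′ → ℂ`:
`Ψ` is integrable on `T′^{reg}` for `tT` iff `Ψ ∘ e` is integrable on `T_H^{G-reg}` for `tH`, and `∫_{T′^{reg}} Ψ dtT = ∫_{T_H^{G-reg}} Ψ(e s) dtH(s)`.
[cite: Rogawski1990, §12.5 p. 183] [cite: LanglandsShelstad1987, §1.3] -/
theorem integrableOn_and_setIntegral_comp_embedding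
    (hns : ∀ w : PlacesOver L v, IsCMField.complexConj L • w.1 = w.1)
    [MeasurableSpace (Gqs L v)] [BorelSpace (Gqs L v)] [LocallyCompactSpace (Gqs L v)] [SecondCountableTopology (Gqs L v)] [T2Space (Gqs L v)]
    [MeasurableSpace ((UnitaryGroup.cmDatum L 2 (Matrix.of fun i j : Fin 2 => if i.val + j.val + 1 = 2 then (1 : L) else 0)).Local v ×
      (UnitaryGroup.cmDatum L 1 (Matrix.of fun i j : Fin 1 => if i.val + j.val + 1 = 1 then (1 : L) else 0)).Local v)]
    [BorelSpace ((UnitaryGroup.cmDatum L 2 (Matrix.of fun i j : Fin 2 => if i.val + j.val + 1 = 2 then (1 : L) else 0)).Local v ×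
      (UnitaryGroup.cmDatum L 1 (Matrix.of fun i j : Fin 1 => if i.val + j.val + 1 = 1 then (1 : L) else 0)).Local v)]
    {TH : Subgroup ((UnitaryGroup.cmDatum L 2 (Matrix.of fun i j : Fin 2 => if i.val + j.val + 1 = 2 then (1 : L) else 0)).Local v ×
      (UnitaryGroup.cmDatum L 1 (Matrix.of fun i j : Fin 1 => if i.val + j.val + 1 = 1 then (1 : L) else 0)).Local v)}
    (tH : Measure ↥TH) [tH.IsHaarMeasure] (htH : tH (compactCore ↥TH) = 1)
    {T' : Subgroup (Gqs L v)} {γ : Gqs L v} (hT' : T' = Subgroup.centralizer ({γ} : Set (Gqs L v)))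
    (tT : Measure ↥T') [tT.IsHaarMeasure] (htT : tT (compactCore ↥T') = 1)
    (e : ↥TH ≃ₜ* ↥T') (he : ∀ s : ↥TH, IsLocalNormPair L (qsForm L) v s.1 (e s).1) (Ψ : ↥T' → ℂ) :
    (IntegrableOn Ψ {t : ↥T' | IsRegularElt (((t : Gqs L v)).val : GL (Fin 3) (UnitaryGroup.LocalRing L v))} tT ↔
      IntegrableOn (fun s : ↥TH => Ψ (e s))
        {s : ↥TH | IsLocalGRegular L v (s : (UnitaryGroup.cmDatum L 2 (Matrix.of fun i j : Fin 2 => if i.val + j.val + 1 = 2 then (1 : L) else 0)).Local v ×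
          (UnitaryGroup.cmDatum L 1 (Matrix.of fun i j : Fin 1 => if i.val + j.val + 1 = 1 then (1 : L) else 0)).Local v)} tH) ∧
    ∫ t in {t : ↥T' | IsRegularElt (((t : Gqs L v)).val : GL (Fin 3) (UnitaryGroup.LocalRing L v))}, Ψ t ∂tT =
      ∫ s in {s : ↥TH | IsLocalGRegular L v (s : (UnitaryGroup.cmDatum L 2 (Matrix.of fun i j : Fin 2 => if i.val + j.val + 1 = 2 then (1 : L) else 0)).Local v ×
          (UnitaryGroup.cmDatum L 1 (Matrix.of fun i j : Fin 1 => if i.val + j.val + 1 = 1 then (1 : L) else 0)).Local v)}, Ψ (e s) ∂tH := by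
  set A : Set ↥T' := {t : ↥T' | IsRegularElt (((t : Gqs L v)).val : GL (Fin 3) (UnitaryGroup.LocalRing L v))} with hA
  obtain ⟨w₀⟩ := (inferInstance : Nonempty (PlacesOver L v))
  have hAm : MeasurableSet A :=
    ((isOpen_setOf_isRegularElt_cmDatum_local (L := L) (H := qsForm L) (v := v) w₀ (hns w₀)).preimage continuous_subtype_val).measurableSet
  have hmap := map_continuousMulEquiv_eq_of_apply_compactCore_eq_one L v TH hT' e tH htH tT htT
  have hpre : (⇑e) ⁻¹' A = {s : ↥TH | IsLocalGRegular L v (s : (UnitaryGroup.cmDatum L 2 (Matrix.of fun i j : Fin 2 => if i.val + j.val + 1 = 2 then (1 : L) else 0)).Local v ×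
      (UnitaryGroup.cmDatum L 1 (Matrix.of fun i j : Fin 1 => if i.val + j.val + 1 = 1 then (1 : L) else 0)).Local v)} := by
    ext s
    simp only [hA, Set.mem_preimage, Set.mem_setOf_eq]
    exact (isLocalGRegular_iff_isRegularElt_of_isLocalNormPair L v (he s)).symm
  have hind : (A.indicator Ψ) ∘ (⇑e) = ((⇑e) ⁻¹' A).indicator (fun s => Ψ (e s)) := by
    funext s
    exact (Set.indicator_comp_right (⇑e) (g := Ψ) (s := A) (x := s)).symm
  constructor
  · have hAm' : MeasurableSet ((⇑e) ⁻¹' A) := hAm.preimage e.continuous.measurable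
    rw [← hpre, ← integrable_indicator_iff hAm, ← integrable_indicator_iff hAm', ← hind, ← hmap]
    exact integrable_map_equiv e.toHomeomorph.toMeasurableEquiv (A.indicator Ψ)
  · calc ∫ t in A, Ψ t ∂tT
        = ∫ t, A.indicator Ψ t ∂(Measure.map e tH) := by rw [integral_indicator hAm, hmap]
      _ = ∫ s, A.indicator Ψ (e s) ∂tH := integral_map_equiv e.toHomeomorph.toMeasurableEquiv _
      _ = ∫ s, ((⇑e) ⁻¹' A).indicator (fun s => Ψ (e s)) s ∂tH := integral_congr_ae (ae_of_all _ fun s => congrFun hind s)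
      _ = ∫ s in (⇑e) ⁻¹' A, Ψ (e s) ∂tH := integral_indicator (show MeasurableSet ((⇑e) ⁻¹' A) from hAm.preimage e.continuous.measurable)
      _ = _ := by rw [hpre]

/-! ## §2 The exchange: ★ (N4)(c) at `T′ = Z_G(γ)` read on `T_H = Z_H(γ₀)` along `e` -/

set_option maxHeartbeats 1600000 in
set_option synthInstance.maxHeartbeats 400000 in
-- instance-term unification on the CM local carriers (as ★ (N4))
/-- **(A1′)-D «EXCHANGE» — the tube formula at the `G`-Cartan `e(T_H) = Z_G(γ)`, parametrised by `e`.**  `T_H = Z_H(γ₀)` (`γ₀` `G`-regular), `γ ∈ G` regular, `e : T_H ≃ₜ* Z_G(γ)`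
matching pointwise (`∀ s, ι_v(s) ↔ e s`), `tH`, `tT` THE compact-core-normalised Haar measures (`tT` inversion-symmetric), `mQv` canonical, `f` measurable, `K : Z_G(γ) → ℂ` arbitrary;
under the two (A0)-class integrability inputs (`f · orbitSum K` on `G_{Z_G(γ)}`; the torus-side integrand on `Z_G(γ)^{reg}`):
`∫_{G_{Z_G(γ)}} f(y) · (Σ_{t ∈ Z_G(γ), t ∼ y} K(t)) dνQv(y) = ∫_{s ∈ T_H, G-regular} √(∏_w |disc χ_{e s}|_w (∏_w |det (e s)|_w)⁻²) • (K(e s) · classOrbitalIntegral mQv f ⟦e s⟧) dtH(s)`.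
[cite: Rogawski1990, §12.5 pp. 182–183, Lemma 12.5.1] [cite: HarishChandra1970, Lemma 42] [cite: LanglandsShelstad1987, §1.3] -/
theorem setIntegral_mul_orbitSum_embedding_eq
    (hns : ∀ w : PlacesOver L v, IsCMField.complexConj L • w.1 = w.1)
    [MeasurableSpace (Gqs L v)] [BorelSpace (Gqs L v)] [LocallyCompactSpace (Gqs L v)] [SecondCountableTopology (Gqs L v)] [T2Space (Gqs L v)]
    [∀ γ' : Gqs L v, MeasurableSpace (Gqs L v ⧸ Subgroup.centralizer ({γ'} : Set (Gqs L v)))]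
    [∀ γ' : Gqs L v, BorelSpace (Gqs L v ⧸ Subgroup.centralizer ({γ'} : Set (Gqs L v)))]
    [MeasurableSpace ((UnitaryGroup.cmDatum L 2 (Matrix.of fun i j : Fin 2 => if i.val + j.val + 1 = 2 then (1 : L) else 0)).Local v ×
      (UnitaryGroup.cmDatum L 1 (Matrix.of fun i j : Fin 1 => if i.val + j.val + 1 = 1 then (1 : L) else 0)).Local v)]
    [BorelSpace ((UnitaryGroup.cmDatum L 2 (Matrix.of fun i j : Fin 2 => if i.val + j.val + 1 = 2 then (1 : L) else 0)).Local v ×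
      (UnitaryGroup.cmDatum L 1 (Matrix.of fun i j : Fin 1 => if i.val + j.val + 1 = 1 then (1 : L) else 0)).Local v)]
    (νQv : Measure (Gqs L v)) [νQv.IsHaarMeasure] [νQv.IsMulRightInvariant]
    {mQv : OrbitalMeasureFamily (Gqs L v)} (hcanQ : mQv.IsCanonical (fun γ' => IsRegularElt (γ'.val : GL (Fin 3) (UnitaryGroup.LocalRing L v))) νQv)
    -- the `H`-Cartan
    {TH : Subgroup ((UnitaryGroup.cmDatum L 2 (Matrix.of fun i j : Fin 2 => if i.val + j.val + 1 = 2 then (1 : L) else 0)).Local v ×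
      (UnitaryGroup.cmDatum L 1 (Matrix.of fun i j : Fin 1 => if i.val + j.val + 1 = 1 then (1 : L) else 0)).Local v)}
    (tH : Measure ↥TH) [tH.IsHaarMeasure] (htH : tH (compactCore ↥TH) = 1)
    -- the `G`-Cartan
    {T' : Subgroup (Gqs L v)} {γ : Gqs L v} (hγ : IsRegularElt (γ.val : GL (Fin 3) (UnitaryGroup.LocalRing L v)))
    (hT' : T' = Subgroup.centralizer ({γ} : Set (Gqs L v)))
    [MeasurableSpace (Gqs L v ⧸ T')] [BorelSpace (Gqs L v ⧸ T')]
    (tT : Measure ↥T') [tT.IsHaarMeasure] [tT.IsInvInvariant] (htT : tT (compactCore ↥T') = 1)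
    -- the embedding
    (e : ↥TH ≃ₜ* ↥T') (he : ∀ s : ↥TH, IsLocalNormPair L (qsForm L) v s.1 (e s).1)
    -- the data (`K` on the `G`-Cartan; read on `T_H` as `K ∘ e`)
    (f : Gqs L v → ℂ) (hf : Measurable f) (K : ↥T' → ℂ)
    (hfκ : IntegrableOn (fun y => f y * ∑ᶠ t : ↥T', {t' : ↥T' | IsConj ((t' : Gqs L v)) y}.indicator K t)
      {x | ∃ g t : Gqs L v, t ∈ T' ∧ IsRegularElt (t.val : GL (Fin 3) (UnitaryGroup.LocalRing L v)) ∧ g * t * g⁻¹ = x} νQv)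
    (hK : IntegrableOn (fun t : ↥T' =>
        ((NNReal.sqrt
            ((∏ w : PlacesOver L v, IsNonarchimedeanLocalField.normAbs (w.1.adicCompletion L)
                ((((t : Gqs L v).val : GL (Fin 3) (UnitaryGroup.LocalRing L v)).val.charpoly.discr) w)) *
              ((∏ w : PlacesOver L v, IsNonarchimedeanLocalField.normAbs (w.1.adicCompletion L)
                ((((t : Gqs L v).val : GL (Fin 3) (UnitaryGroup.LocalRing L v)).val.det) w)) ^ 2)⁻¹) : ℝ≥0) : ℝ) •
          (K t * classOrbitalIntegral mQv f (ConjClasses.mk (t : Gqs L v))))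
      {t : ↥T' | IsRegularElt (((t : Gqs L v)).val : GL (Fin 3) (UnitaryGroup.LocalRing L v))} tT) :
    ∫ y in {x | ∃ g t : Gqs L v, t ∈ T' ∧ IsRegularElt (t.val : GL (Fin 3) (UnitaryGroup.LocalRing L v)) ∧ g * t * g⁻¹ = x},
        f y * ∑ᶠ t : ↥T', {t' : ↥T' | IsConj ((t' : Gqs L v)) y}.indicator K t ∂νQv =
      ∫ s in {s : ↥TH | IsLocalGRegular L v (s : (UnitaryGroup.cmDatum L 2 (Matrix.of fun i j : Fin 2 => if i.val + j.val + 1 = 2 then (1 : L) else 0)).Local v ×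
          (UnitaryGroup.cmDatum L 1 (Matrix.of fun i j : Fin 1 => if i.val + j.val + 1 = 1 then (1 : L) else 0)).Local v)},
        ((NNReal.sqrt
            ((∏ w : PlacesOver L v, IsNonarchimedeanLocalField.normAbs (w.1.adicCompletion L)
                (((((e s : ↥T') : Gqs L v).val : GL (Fin 3) (UnitaryGroup.LocalRing L v)).val.charpoly.discr) w)) *
              ((∏ w : PlacesOver L v, IsNonarchimedeanLocalField.normAbs (w.1.adicCompletion L)
                (((((e s : ↥T') : Gqs L v).val : GL (Fin 3) (UnitaryGroup.LocalRing L v)).val.det) w)) ^ 2)⁻¹) : ℝ≥0) : ℝ) •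
          (K (e s) * classOrbitalIntegral mQv f (ConjClasses.mk ((e s : ↥T') : Gqs L v))) ∂tH := by
  -- ### ★ (N4)(c) at `K`
  rw [setIntegral_mul_orbitSum_cartanSet_eq L v hns νQv hcanQ hγ hT' tT htT f hf K hfκ hK]
  -- ### change of variables `t = e s`: `tT = e_* tH`
  set Ψ : ↥T' → ℂ := fun t =>
    ((NNReal.sqrt
        ((∏ w : PlacesOver L v, IsNonarchimedeanLocalField.normAbs (w.1.adicCompletion L)
            ((((t : Gqs L v).val : GL (Fin 3) (UnitaryGroup.LocalRing L v)).val.charpoly.discr) w)) *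
          ((∏ w : PlacesOver L v, IsNonarchimedeanLocalField.normAbs (w.1.adicCompletion L)
            ((((t : Gqs L v).val : GL (Fin 3) (UnitaryGroup.LocalRing L v)).val.det) w)) ^ 2)⁻¹) : ℝ≥0) : ℝ) •
      (K t * classOrbitalIntegral mQv f (ConjClasses.mk (t : Gqs L v))) with hΨ
  set A : Set ↥T' := {t : ↥T' | IsRegularElt (((t : Gqs L v)).val : GL (Fin 3) (UnitaryGroup.LocalRing L v))} with hA
  obtain ⟨w₀⟩ := (inferInstance : Nonempty (PlacesOver L v))
  have hAm : MeasurableSet A :=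
    ((isOpen_setOf_isRegularElt_cmDatum_local (L := L) (H := qsForm L) (v := v) w₀ (hns w₀)).preimage continuous_subtype_val).measurableSet
  have hmap := map_continuousMulEquiv_eq_of_apply_compactCore_eq_one L v TH hT' e tH htH tT htT
  -- the regular set pulls back to the `G`-regular set
  have hpre : (⇑e) ⁻¹' A = {s : ↥TH | IsLocalGRegular L v (s : (UnitaryGroup.cmDatum L 2 (Matrix.of fun i j : Fin 2 => if i.val + j.val + 1 = 2 then (1 : L) else 0)).Local v ×
      (UnitaryGroup.cmDatum L 1 (Matrix.of fun i j : Fin 1 => if i.val + j.val + 1 = 1 then (1 : L) else 0)).Local v)} := by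
    ext s
    simp only [hA, Set.mem_preimage, Set.mem_setOf_eq]
    exact (isLocalGRegular_iff_isRegularElt_of_isLocalNormPair L v (he s)).symm
  calc ∫ t in A, Ψ t ∂tT
      = ∫ t, A.indicator Ψ t ∂(Measure.map e tH) := by rw [integral_indicator hAm, hmap]
    _ = ∫ s, A.indicator Ψ (e s) ∂tH := integral_map_equiv e.toHomeomorph.toMeasurableEquiv _
    _ = ∫ s, ((⇑e) ⁻¹' A).indicator (Ψ ∘ e) s ∂tH := by
        refine integral_congr_ae (ae_of_all _ fun s => ?_)
        exact (Set.indicator_comp_right (⇑e) (g := Ψ) (s := A) (x := s)).symm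
    _ = ∫ s in (⇑e) ⁻¹' A, Ψ (e s) ∂tH := integral_indicator (hAm.preimage e.continuous.measurable)
    _ = _ := by rw [hpre]

end CM

end Summit.HodgeConjecture.HodgeConjecture.Cruxes.H413.F0P3cStCharTSUpTrExchange

end
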